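import Literature.Analysis.FluidPDE.PressureSliceDecay
import Literature.Analysis.FluidPDE.PressureDecayEstimate
import Literature.Analysis.FluidPDE.DistributionalPressurePoisson
import Literature.Analysis.FluidPDE.WeakSolutionProofs
import Literature.Analysis.FluidPDE.NormalisedPressureLpBoundProofs
import HarnessLib

/-!
# Time slices of the pressure equation, and the slice-wise route to the local pressure decay
# estimate

Analysis/FluidPDE support file (all results proved). Its subject is the time slicing of the
distributional pressure equation `∫∫ (D²θ(u, u) + p Δθ) = 0` of a distributional Navier–Stokes
solution (`IsDistributionalNSSolutionOn.integral_hessian_add_pressure_laplacian_eq_zero`,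
`FluidPDE/DistributionalPressurePoisson`): for a.e. time `t` the slice `(u(t), p(t))` satisfies
`∫ p(t) Δψ = -∫ D²ψ(u(t), u(t))` for **all** test functions `ψ` on the space section — the
step "for all possible values of `s`" of the local regularity literature (Seregin 2014, §6.3),
needed whenever a per-time pressure decomposition `p = p₁ + p₂` is performed. As an application
the file carries out the printed, slice-wise proof of the local pressure decay estimate
`seregin_sverak_pressure_decay` (`FluidPDE/PressureDecayEstimate`; Seregin–Šverák 2009, (as13):
`D(ϱ) ≤ c [(ϱ/r) D(r) + (r/ϱ)² C(r)]` on balls) from Stein's bound on test fields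
(`seregin_sverak_pressure_decay_of_stein`; with the tree's
`stein1970_normalisedPressure_Lp_bound_holds` this is a second, independent proof of the tree's
`seregin_sverak_pressure_decay_holds` of `FluidPDE/PressureDecayEstimateProofs`, which argues on
Seregin–Šverák's coordinate cylinders in space–time instead), and records the unconditional forms
of the whole-space pressure of an `L³` field (`exists_wholeSpacePressure_three`) and of the
one-slice decay estimate (`setLIntegral_pressure_ball_le`).

The printed argument (Seregin 2005, (p9)–(p12); Seregin, *Lecture notes* 2014, §6.3) is
slice-wise in time: at a.e. time `t` the pressure equation `-Δ p = div div (u ⊗ u)` holds in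
`B_r` and the one-slice estimate `∫_{B_ϱ} |p|^{3/2} ≤ c [(ϱ/r)³ ∫_{B_r} |p|^{3/2} + ∫_{B_r} |u|³]`
(`setLIntegral_pressure_ball_le_of_stein`, `FluidPDE/PressureSliceDecay`) is integrated over
`t ∈ (t₀ - ϱ², t₀)`; `ϱ⁻² (ϱ/r)³ = (ϱ/r) r⁻²` and `ϱ⁻² ≤ (r/ϱ)² r⁻²` give (as13). This file
supplies the time slicing of the distributional pressure equation
`∫∫ (D²θ(u, u) + p Δθ) = 0`
(`IsDistributionalNSSolutionOn.integral_hessian_add_pressure_laplacian_eq_zero`,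
`FluidPDE/DistributionalPressurePoisson`):

* `exists_countable_testFunctions_dense_hessian`: countably many test functions supported in a
  compact `K` approximate every test function supported in `K` together with its Hessian and
  Laplacian, uniformly (second countability of `C(X, (X →L X →L ℝ) × ℝ)`; the second-order
  analogue of `exists_countable_testFunctions_dense` of `FluidPDE/WeakGradientSlicing`);
* `IsDistributionalNSSolutionOn.ae_slice_pressure_identity`: on a product region `(a, b) × Ω`,
  for each `ψ ∈ C_c^∞(Ω)` the identity `∫ (D²ψ(u(t), u(t)) + p(t) Δψ) = 0` holds for a.e. `t`
  (test with `η(t) ψ(x)` and use the fundamental lemma of the calculus of variations in `t`);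
* `IsDistributionalNSSolutionOn.ae_forall_slice_pressure_identity`: for a.e. `t` (at which the
  slices are locally integrable) the identity holds for **all** `ψ ∈ C_c^∞(Ω)`, in the split
  form `∫ p(t) Δψ = -∫ D²ψ(u(t), u(t))`;
* `seregin_sverak_pressure_decay_of_stein`: the assembly (restriction to `Q_r(z)` by
  `IsDistributionalNSSolutionOn.of_le`, Tonelli on `Q_r(z) = (t₀ - r², t₀) × B_r(x₀)`, the case
  distinctions `D(r) = ∞ ∨ C(r) = ∞` and `ϱ > r/2`);
* `exists_wholeSpacePressure_three`, `setLIntegral_pressure_ball_le`: the unconditional forms of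
  `exists_wholeSpacePressure_of_stein` (`FluidPDE/WholeSpacePressureL3`) and
  `setLIntegral_pressure_ball_le_of_stein` (`FluidPDE/PressureSliceDecay`), by
  `stein1970_normalisedPressure_Lp_bound_holds` (`FluidPDE/NormalisedPressureLpBoundProofs`).

## Mathlib search

Mathlib (this pin) has Fubini–Tonelli (`lintegral_prod`, `integral_prod`,
`AEStronglyMeasurable.prodMk_left`), the fundamental lemma of the calculus of variations
(`IsOpen.ae_eq_zero_of_integral_contDiff_smul_eq_zero`) and second countability of
`C(X, Y)` (`ContinuousMap.instSecondCountableTopology`), but no weak/distributional PDE slicing.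

## References

* G. Seregin, V. Šverák, *On Type I singularities of the local axi-symmetric solutions of the
  Navier–Stokes equations*, Comm. PDE 34 (2009), arXiv:0804.1803, (as13). [SereginSverak2009]
* G. Seregin, *Navier–Stokes equations: almost `L_{3,∞}`-case*, J. Math. Fluid Mech. 9 (2007),
  arXiv:math/0510396, (p9)–(p12). [Seregin2005]
* G. Seregin, *Lecture Notes on Regularity Theory for the Navier–Stokes Equations*, World
  Scientific 2014, §6.3 (proof of Prop. 3.10). [Seregin2014]
* E. M. Stein, *Singular Integrals and Differentiability Properties of Functions*, Princeton
  1970, Ch. II §4.2 Thm 3. [Stein1971]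
-/

noncomputable section

open MeasureTheory Set Function Filter Topology TopologicalSpace Metric
open scoped NNReal ENNReal InnerProductSpace RealInnerProductSpace ContDiff Laplacian

namespace Literature.Analysis.FluidPDE

/-! ### Countably many test functions control all Hessians and Laplacians -/

section Density

variable {X : Type*} [NormedAddCommGroup X] [InnerProductSpace ℝ X] [FiniteDimensional ℝ X]

-- nested operator types `X →L[ℝ] X →L[ℝ] ℝ`
set_option maxSynthPendingDepth 3 in
/-- **Countably many test functions control all second-order jets.** For an open set `Ω` and a
compact `K`, there is a countable family `D` of test functions on `Ω` supported in `K` such that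
every test function `ψ` on `Ω` supported in `K` is the limit of a sequence in `D` whose Hessians
and Laplacians converge uniformly to those of `ψ` (separability of the subspace
`{(D²ψ, Δψ)} ⊆ C(X, (X →L X →L ℝ) × ℝ)` for the compact-open topology, which is second countable;
locally uniform convergence is uniform for functions supported in `K`; cf.
`exists_countable_testFunctions_dense` for first-order jets). [folklore] -/
theorem exists_countable_testFunctions_dense_hessian (Ω : Opens X) {K : Set X}
    (hK : IsCompact K) :
    ∃ D : Set (X → ℝ), D.Countable ∧
      (∀ ψ ∈ D, FunctionSpaces.IsTestFunctionOn Ω ψ ∧ tsupport ψ ⊆ K) ∧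
      ∀ ψ : X → ℝ, FunctionSpaces.IsTestFunctionOn Ω ψ → tsupport ψ ⊆ K →
        ∃ s : ℕ → X → ℝ, (∀ k, s k ∈ D) ∧
          TendstoUniformly (fun k => fderiv ℝ (fderiv ℝ (s k))) (fderiv ℝ (fderiv ℝ ψ)) atTop ∧
          TendstoUniformly (fun k => Δ (s k)) (Δ ψ) atTop := by
  classical
  set T : Set (X → ℝ) := {ψ | FunctionSpaces.IsTestFunctionOn Ω ψ ∧ tsupport ψ ⊆ K} with hT
  have hJc : ∀ ψ ∈ T, Continuous (fun x => (fderiv ℝ (fderiv ℝ ψ) x, Δ ψ x)) := fun ψ hψ => by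
    have h2 : ContDiff ℝ 2 ψ := contDiff_infty.1 hψ.1.contDiff 2
    exact ((h2.fderiv_right (m := 1) (by norm_num)).continuous_fderiv one_ne_zero).prodMk
      (FluidPDE.continuous_laplacian h2)
  set S : Set C(X, (X →L[ℝ] X →L[ℝ] ℝ) × ℝ) :=
    {F | ∃ ψ ∈ T, ⇑F = fun x => (fderiv ℝ (fderiv ℝ ψ) x, Δ ψ x)} with hS
  have hsel : ∀ F : S, ∃ ψ ∈ T, ⇑(F : C(X, (X →L[ℝ] X →L[ℝ] ℝ) × ℝ)) =
      fun x => (fderiv ℝ (fderiv ℝ ψ) x, Δ ψ x) := fun F => F.2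
  choose sel hselT hselF using hsel
  obtain ⟨d, hdc, hdd⟩ := TopologicalSpace.exists_countable_dense S
  refine ⟨sel '' d, hdc.image _, ?_, ?_⟩
  · rintro ψ ⟨F, -, rfl⟩
    exact hselT F
  · intro ψ hψ hψK
    have hψT : ψ ∈ T := ⟨hψ, hψK⟩
    set Fψ : C(X, (X →L[ℝ] X →L[ℝ] ℝ) × ℝ) :=
      ⟨fun x => (fderiv ℝ (fderiv ℝ ψ) x, Δ ψ x), hJc ψ hψT⟩ with hFψ
    have hFψS : Fψ ∈ S := ⟨ψ, hψT, rfl⟩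
    have hcl : (⟨Fψ, hFψS⟩ : S) ∈ closure d := by
      rw [hdd.closure_eq]; exact mem_univ _
    obtain ⟨c, hcd, hclim⟩ := mem_closure_iff_seq_limit.1 hcl
    refine ⟨fun k => sel (c k), fun k => ⟨c k, hcd k, rfl⟩, ?_⟩
    have h1 : Tendsto (fun k => ((c k : S) : C(X, (X →L[ℝ] X →L[ℝ] ℝ) × ℝ))) atTop (𝓝 Fψ) :=
      (continuous_subtype_val.tendsto _).comp hclim
    have h2 := ContinuousMap.tendsto_iff_tendstoLocallyUniformly.1 h1
    have h3 : TendstoUniformlyOn (fun k x => ((c k : S) : C(X, (X →L[ℝ] X →L[ℝ] ℝ) × ℝ)) x) Fψ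
        atTop K := (tendstoLocallyUniformly_iff_forall_isCompact.1 h2) K hK
    have h4 : ∀ k x, ((c k : S) : C(X, (X →L[ℝ] X →L[ℝ] ℝ) × ℝ)) x =
        (fderiv ℝ (fderiv ℝ (sel (c k))) x, Δ (sel (c k)) x) := fun k x =>
      congrFun (hselF (c k)) x
    have h5 : TendstoUniformly
        (fun k x => (fderiv ℝ (fderiv ℝ (sel (c k))) x, Δ (sel (c k)) x))
        (fun x => (fderiv ℝ (fderiv ℝ ψ) x, Δ ψ x)) atTop := by
      rw [Metric.tendstoUniformly_iff]
      intro ε hε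
      filter_upwards [(Metric.tendstoUniformlyOn_iff.1 h3) ε hε] with k hk x
      by_cases hx : x ∈ K
      · have := hk x hx
        rwa [h4 k x] at this
      · have hψ1 : fderiv ℝ (fderiv ℝ ψ) x = 0 :=
          fderiv_fderiv_eq_zero_of_notMem_tsupport fun h' => hx (hψK h')
        have hψ0 : Δ ψ x = 0 :=
          FluidPDE.laplacian_eq_zero_of_notMem_tsupport fun h' => hx (hψK h')
        have hs1 : fderiv ℝ (fderiv ℝ (sel (c k))) x = 0 :=
          fderiv_fderiv_eq_zero_of_notMem_tsupport fun h' => hx ((hselT (c k)).2 h')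
        have hs0 : Δ (sel (c k)) x = 0 :=
          FluidPDE.laplacian_eq_zero_of_notMem_tsupport fun h' => hx ((hselT (c k)).2 h')
        simp [hψ0, hψ1, hs0, hs1, hε]
    refine ⟨?_, ?_⟩
    · have := uniformContinuous_fst.comp_tendstoUniformly h5
      simpa only [Function.comp_def] using this
    · have := uniformContinuous_snd.comp_tendstoUniformly h5
      simpa only [Function.comp_def] using this

end Density

/-! ### Time slices of the pressure equation -/

section SliceIdentity

variable {E : Type*} [NormedAddCommGroup E] [InnerProductSpace ℝ E] [FiniteDimensional ℝ E]
  [MeasurableSpace E] [BorelSpace E]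

-- nested operator types
set_option maxSynthPendingDepth 3 in
omit [FiniteDimensional ℝ E] [MeasurableSpace E] [BorelSpace E] in
/-- Measurability of the quadratic pairing `a ↦ Θ(a)(v(a), v(a))` of an a.e.-strongly
measurable operator field with an a.e.-strongly measurable vector field. [folklore] -/
theorem aestronglyMeasurable_bilin_apply_self {α : Type*} [MeasurableSpace α] {μ : Measure α}
    {Θ : α → E →L[ℝ] E →L[ℝ] ℝ} {v : α → E} (hΘ : AEStronglyMeasurable Θ μ)
    (hv : AEStronglyMeasurable v μ) :
    AEStronglyMeasurable (fun a => Θ a (v a) (v a)) μ := by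
  have h1 : AEStronglyMeasurable (fun a => Θ a (v a)) μ :=
    isBoundedBilinearMap_apply.continuous.comp_aestronglyMeasurable (hΘ.prodMk hv)
  exact isBoundedBilinearMap_apply.continuous.comp_aestronglyMeasurable (h1.prodMk hv)

-- nested operator types
set_option maxSynthPendingDepth 3 in
/-- A continuous operator field `Θ` vanishing off a compact set `K`, paired quadratically with a
field `F` that is square integrable on `K`, gives an integrable function. [folklore] -/
theorem integrable_bilin_apply_self_of_eq_zero_off_compact {K : Set E}
    (hK : IsCompact K) {Θ : E → E →L[ℝ] E →L[ℝ] ℝ} (hΘ : Continuous Θ)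
    (hΘK : ∀ x ∉ K, Θ x = 0) {F : E → E} (hFm : AEStronglyMeasurable F (volume.restrict K))
    (hF : IntegrableOn (fun x => ‖F x‖ ^ 2) K volume) :
    Integrable (fun x => Θ x (F x) (F x)) (volume : Measure E) := by
  obtain ⟨M, hM⟩ := hΘ.bounded_above_of_compact_support (HasCompactSupport.intro hK hΘK)
  have h1 : IntegrableOn (fun x => Θ x (F x) (F x)) K volume := by
    refine Integrable.mono' (hF.const_mul M)
      (aestronglyMeasurable_bilin_apply_self hΘ.aestronglyMeasurable hFm) ?_
    filter_upwards with x
    calc ‖Θ x (F x) (F x)‖ ≤ ‖Θ x‖ * ‖F x‖ * ‖F x‖ := (Θ x).le_opNorm₂ _ _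
      _ = ‖Θ x‖ * ‖F x‖ ^ 2 := by ring
      _ ≤ M * ‖F x‖ ^ 2 := mul_le_mul_of_nonneg_right (hM x) (sq_nonneg _)
  refine (integrableOn_iff_integrable_of_support_subset fun x hx => ?_).1 h1
  by_contra hxK
  exact (Function.mem_support.1 hx) (by simp [hΘK x hxK])

-- nested operator types
set_option maxSynthPendingDepth 3 in
/-- Integrals of `Θₖ(F, F)` converge to the integral of `Θ(F, F)` when `Θₖ → Θ` uniformly, all
these continuous operator fields vanish off a fixed compact set `K`, and `|F|²` is integrable on
`K` (dominated convergence). [folklore] -/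
theorem tendsto_integral_bilin_apply_self_of_tendstoUniformly {K : Set E}
    (hK : IsCompact K) {F : E → E} (hFm : AEStronglyMeasurable F (volume.restrict K))
    (hF : IntegrableOn (fun x => ‖F x‖ ^ 2) K volume) {Θ : ℕ → E → E →L[ℝ] E →L[ℝ] ℝ}
    {Θ' : E → E →L[ℝ] E →L[ℝ] ℝ} (hΘ : ∀ k, Continuous (Θ k)) (hΘ' : Continuous Θ')
    (hΘK : ∀ k, ∀ x ∉ K, Θ k x = 0) (hlim : TendstoUniformly Θ Θ' atTop) :
    Tendsto (fun k => ∫ x, Θ k x (F x) (F x)) atTop (𝓝 (∫ x, Θ' x (F x) (F x))) := by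
  have hΘ'K : ∀ x ∉ K, Θ' x = 0 := fun x hx =>
    tendsto_nhds_unique (hlim.tendsto_at x)
      (tendsto_const_nhds.congr fun k => (hΘK k x hx).symm)
  obtain ⟨M, hM⟩ := hΘ'.bounded_above_of_compact_support (HasCompactSupport.intro hK hΘ'K)
  have hrepr : ∀ k, (fun x => Θ k x (F x) (F x)) = K.indicator (fun x => Θ k x (F x) (F x)) := by
    intro k; funext x
    by_cases hx : x ∈ K
    · rw [indicator_of_mem hx]
    · rw [indicator_of_notMem hx, hΘK k x hx]; simp
  refine tendsto_integral_filter_of_dominated_convergence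
    (K.indicator fun x => (M + 1) * ‖F x‖ ^ 2) ?_ ?_ ?_ ?_
  · refine Eventually.of_forall fun k => ?_
    rw [hrepr k, aestronglyMeasurable_indicator_iff hK.measurableSet]
    exact aestronglyMeasurable_bilin_apply_self (hΘ k).aestronglyMeasurable hFm
  · have h1 : ∀ᶠ k in atTop, ∀ x, dist (Θ' x) (Θ k x) < 1 :=
      (Metric.tendstoUniformly_iff.1 hlim) 1 one_pos
    filter_upwards [h1] with k hk
    refine Eventually.of_forall fun x => ?_
    by_cases hx : x ∈ K
    · rw [indicator_of_mem hx]
      have hk' : ‖Θ k x‖ ≤ M + 1 := by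
        have := hk x
        rw [dist_eq_norm] at this
        calc ‖Θ k x‖ = ‖Θ' x - (Θ' x - Θ k x)‖ := by rw [sub_sub_cancel]
          _ ≤ ‖Θ' x‖ + ‖Θ' x - Θ k x‖ := norm_sub_le _ _
          _ ≤ M + 1 := add_le_add (hM x) this.le
      calc ‖Θ k x (F x) (F x)‖ ≤ ‖Θ k x‖ * ‖F x‖ * ‖F x‖ := (Θ k x).le_opNorm₂ _ _
        _ = ‖Θ k x‖ * ‖F x‖ ^ 2 := by ring
        _ ≤ (M + 1) * ‖F x‖ ^ 2 := mul_le_mul_of_nonneg_right hk' (sq_nonneg _)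
    · rw [indicator_of_notMem hx, hΘK k x hx]; simp
  · have hb : IntegrableOn (fun x => (M + 1) * ‖F x‖ ^ 2) K volume := hF.const_mul (M + 1)
    exact hb.integrable_indicator hK.measurableSet
  · refine Eventually.of_forall fun x => ?_
    have h1 : Tendsto (fun k => Θ k x (F x)) atTop (𝓝 (Θ' x (F x))) :=
      (isBoundedBilinearMap_apply.continuous.tendsto (Θ' x, F x)).comp
        ((hlim.tendsto_at x).prodMk_nhds tendsto_const_nhds)
    exact (isBoundedBilinearMap_apply.continuous.tendsto (Θ' x (F x), F x)).comp
      (h1.prodMk_nhds tendsto_const_nhds)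

variable {Q : Opens (ℝ × E)} {ν : ℝ} {f u : ℝ → E → E} {p : ℝ → E → ℝ}

-- nested operator types
set_option maxSynthPendingDepth 3 in
/-- **Integrability of the tested pressure-equation integrand.** For a distributional solution
on `Q`, a continuous operator field `Θ` and a continuous scalar `c` on space–time which vanish
at the points of a measurable set `S` outside a compact `C ⊆ Q`, the integrand
`Θ(u, u) + p c` is integrable on `S` (`|u|²` and `p` are integrable on `C`). [folklore] -/
theorem IsDistributionalNSSolutionOn.integrableOn_hessian_add_pressure_mul
    (hns : IsDistributionalNSSolutionOn Q ν f u p)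
    {Θ : ℝ × E → E →L[ℝ] E →L[ℝ] ℝ} {c : ℝ × E → ℝ} (hΘ : Continuous Θ) (hc : Continuous c)
    {C : Set (ℝ × E)} (hC : IsCompact C) (hCQ : C ⊆ (Q : Set (ℝ × E)))
    {S : Set (ℝ × E)} (hS : MeasurableSet S)
    (hΘ0 : ∀ z ∈ S, z ∉ C → Θ z = 0) (hc0 : ∀ z ∈ S, z ∉ C → c z = 0) :
    IntegrableOn (fun z : ℝ × E => Θ z (u z.1 z.2) (u z.1 z.2) + p z.1 z.2 * c z) S volume := by
  obtain ⟨hu, hu2, hp, -, -⟩ := hns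
  have huC : IntegrableOn (uncurry u) C volume := hu.integrableOn_compact_subset hCQ hC
  have hu2C : IntegrableOn (fun z => ‖uncurry u z‖ ^ 2) C volume :=
    hu2.integrableOn_compact_subset hCQ hC
  have hpC : IntegrableOn (uncurry p) C volume := hp.integrableOn_compact_subset hCQ hC
  obtain ⟨M, hM⟩ := hC.exists_bound_of_continuousOn hΘ.continuousOn
  have h1 : IntegrableOn (fun z : ℝ × E => Θ z (u z.1 z.2) (u z.1 z.2)) C volume := by
    refine Integrable.mono' (hu2C.const_mul M)
      (aestronglyMeasurable_bilin_apply_self hΘ.aestronglyMeasurable huC.aestronglyMeasurable) ?_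
    filter_upwards [ae_restrict_mem hC.measurableSet] with z hz
    calc ‖Θ z (u z.1 z.2) (u z.1 z.2)‖ ≤ ‖Θ z‖ * ‖u z.1 z.2‖ * ‖u z.1 z.2‖ := (Θ z).le_opNorm₂ _ _
      _ = ‖Θ z‖ * ‖uncurry u z‖ ^ 2 := by simp only [uncurry]; ring
      _ ≤ M * ‖uncurry u z‖ ^ 2 := mul_le_mul_of_nonneg_right (hM z hz) (sq_nonneg _)
  have h2 : IntegrableOn (fun z : ℝ × E => p z.1 z.2 * c z) C volume :=
    hpC.mul_continuousOn hc.continuousOn hC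
  refine (h1.add h2).of_forall_sdiff_eq_zero hS fun z hz => ?_
  simp [hΘ0 z hz.1 hz.2, hc0 z hz.1 hz.2]

variable {a b : ℝ} {Ω : Opens E}

-- nested operator types
set_option maxSynthPendingDepth 3 in
/-- **The slice identity for one test function.** Let `(u, p)` be a distributional solution
of the Navier–Stokes system on the product region `(a, b) × Ω` with a force `f ∈ L¹_loc`
satisfying the divergence constraint, so that the pressure equation
`∫∫ (D²θ(u, u) + p Δθ) = 0` holds for all `θ ∈ C_c^∞((a, b) × Ω)`
(`integral_hessian_add_pressure_laplacian_eq_zero`). Then for every `ψ ∈ C_c^∞(Ω)`,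
`∫ (D²ψ(u(t), u(t)) + p(t) Δψ) dx = 0` for a.e. `t ∈ (a, b)`: test with `θ = η(t) ψ(x)`,
`η ∈ C_c^∞((a, b))`, and apply the fundamental lemma of the calculus of variations in `t`
(Seregin 2014, §6.3, "for all possible values of `s`"; the device of
`HasWeakSpatialGradientOn.ae_slice_identity`). [cite: Seregin2014, §6.3 (proof of Prop. 3.10)] -/
theorem IsDistributionalNSSolutionOn.ae_slice_pressure_identity
    (hns : IsDistributionalNSSolutionOn
      (⟨Ioo a b ×ˢ (Ω : Set E), isOpen_Ioo.prod Ω.isOpen⟩ : Opens (ℝ × E)) ν f u p)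
    (hf : LocallyIntegrableOn (uncurry f) (Ioo a b ×ˢ (Ω : Set E)) volume)
    (hdivf : ∀ φ : ℝ → E → ℝ,
      IsSpaceTimeTestOn (⟨Ioo a b ×ˢ (Ω : Set E), isOpen_Ioo.prod Ω.isOpen⟩ : Opens (ℝ × E)) φ →
      ∫ z in Ioo a b ×ˢ (Ω : Set E), ⟪f z.1 z.2, gradient (φ z.1) z.2⟫ = 0)
    {ψ : E → ℝ} (hψ : FunctionSpaces.IsTestFunctionOn Ω ψ) :
    ∀ᵐ t ∂(volume.restrict (Ioo a b)),
      ∫ x, (fderiv ℝ (fderiv ℝ ψ) x (u t x) (u t x) + p t x * Δ ψ x) = 0 := by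
  set Q : Opens (ℝ × E) := ⟨Ioo a b ×ˢ (Ω : Set E), isOpen_Ioo.prod Ω.isOpen⟩ with hQ
  set g : ℝ → ℝ := fun t => ∫ x, (fderiv ℝ (fderiv ℝ ψ) x (u t x) (u t x) + p t x * Δ ψ x)
    with hg
  have hψ2 : ContDiff ℝ 2 ψ := contDiff_infty.1 hψ.contDiff 2
  have hHc : Continuous (fderiv ℝ (fderiv ℝ ψ)) :=
    (hψ2.fderiv_right (m := 1) (by norm_num)).continuous_fderiv one_ne_zero
  have hΔc : Continuous (Δ ψ) := FluidPDE.continuous_laplacian hψ2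
  have hH0 : ∀ x ∉ tsupport ψ, fderiv ℝ (fderiv ℝ ψ) x = 0 := fun x hx =>
    fderiv_fderiv_eq_zero_of_notMem_tsupport hx
  have hΔ0 : ∀ x ∉ tsupport ψ, Δ ψ x = 0 := fun x hx =>
    FluidPDE.laplacian_eq_zero_of_notMem_tsupport hx
  -- local integrability of `g` on `(a, b)`: Fubini on `J × E`
  have hloc : LocallyIntegrableOn g (Ioo a b) volume := by
    refine (locallyIntegrableOn_iff isOpen_Ioo.isLocallyClosed).2 fun J hJ hJc => ?_
    have hC : IsCompact (J ×ˢ tsupport ψ) := hJc.prod hψ.hasCompactSupport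
    have hCQ : J ×ˢ tsupport ψ ⊆ (Q : Set (ℝ × E)) := prod_mono hJ hψ.tsupport_subset
    have h1 : IntegrableOn (fun z : ℝ × E =>
        fderiv ℝ (fderiv ℝ ψ) z.2 (u z.1 z.2) (u z.1 z.2) + p z.1 z.2 * Δ ψ z.2)
        (J ×ˢ (univ : Set E)) volume :=
      hns.integrableOn_hessian_add_pressure_mul (hHc.comp continuous_snd)
        (hΔc.comp continuous_snd) hC hCQ (hJc.measurableSet.prod MeasurableSet.univ)
        (fun z hz hzC => hH0 _ fun hx => hzC ⟨(mem_prod.1 hz).1, hx⟩)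
        (fun z hz hzC => hΔ0 _ fun hx => hzC ⟨(mem_prod.1 hz).1, hx⟩)
    have h2 : Integrable (fun z : ℝ × E =>
        fderiv ℝ (fderiv ℝ ψ) z.2 (u z.1 z.2) (u z.1 z.2) + p z.1 z.2 * Δ ψ z.2)
        ((volume.restrict J).prod (volume : Measure E)) := by
      rw [Measure.restrict_prod_eq_prod_univ J]
      exact h1
    exact h2.integral_prod_left
  -- the fundamental lemma of the calculus of variations in `t`
  have hkey : ∀ᵐ t ∂(volume : Measure ℝ), t ∈ Ioo a b → g t = 0 := by
    refine isOpen_Ioo.ae_eq_zero_of_integral_contDiff_smul_eq_zero hloc ?_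
    intro η hη hηc hηs
    have hθ : IsSpaceTimeTestOn Q (fun t x => η t * ψ x) := isSpaceTimeTestOn_mul hη hηc hηs hψ
    have hid := hns.integral_hessian_add_pressure_laplacian_eq_zero hf hdivf hθ
    -- the jets of `x ↦ η t ψ x`
    have hH : ∀ t x, fderiv ℝ (fderiv ℝ (fun y => η t * ψ y)) x =
        η t • fderiv ℝ (fderiv ℝ ψ) x := by
      intro t x
      have h1 : fderiv ℝ (fun y => η t * ψ y) = fun y => η t • fderiv ℝ ψ y := by
        funext y
        exact fderiv_const_mul ((hψ.contDiff.differentiable (by simp)).differentiableAt) _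
      rw [h1]
      exact fderiv_const_smul
        (((hψ2.fderiv_right (m := 1) (by norm_num)).differentiable (by norm_num)).differentiableAt)
        (η t)
    have hL : ∀ t x, Δ (fun y => η t * ψ y) x = η t * Δ ψ x := by
      intro t x
      have e : (fun y => η t * ψ y) = η t • ψ := rfl
      rw [e, InnerProductSpace.laplacian_smul _ hψ2.contDiffAt, smul_eq_mul]
    set F : ℝ × E → ℝ := fun z =>
      η z.1 * (fderiv ℝ (fderiv ℝ ψ) z.2 (u z.1 z.2) (u z.1 z.2) + p z.1 z.2 * Δ ψ z.2) with hF
    have hid' : ∫ z in (Q : Set (ℝ × E)), F z = 0 := by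
      rw [← hid]
      refine setIntegral_congr_fun Q.isOpen.measurableSet fun z _ => ?_
      simp only [hF, hH, hL, smul_apply, smul_eq_mul]
      ring
    -- `F` is integrable on `ℝ × E` and vanishes off `supp η × supp ψ ⊆ Q`
    have hC : IsCompact (tsupport η ×ˢ tsupport ψ) := hηc.prod hψ.hasCompactSupport
    have hCQ : tsupport η ×ˢ tsupport ψ ⊆ (Q : Set (ℝ × E)) := prod_mono hηs hψ.tsupport_subset
    have hout : ∀ z : ℝ × E, z ∉ tsupport η ×ˢ tsupport ψ →
        η z.1 = 0 ∨ (fderiv ℝ (fderiv ℝ ψ) z.2 = 0 ∧ Δ ψ z.2 = 0) := by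
      intro z hz
      rcases not_and_or.1 (fun h => hz (mem_prod.2 h)) with ht | hx
      · exact Or.inl (image_eq_zero_of_notMem_tsupport ht)
      · exact Or.inr ⟨hH0 _ hx, hΔ0 _ hx⟩
    have hF0 : ∀ z ∉ tsupport η ×ˢ tsupport ψ, F z = 0 := by
      intro z hz
      rcases hout z hz with h0 | ⟨h1, h2⟩
      · simp [hF, h0]
      · simp [hF, h1, h2]
    have hFi : Integrable F (volume : Measure (ℝ × E)) := by
      have hηc' : Continuous η := hη.continuous
      have h1 : IntegrableOn (fun z : ℝ × E =>
          (η z.1 • fderiv ℝ (fderiv ℝ ψ) z.2) (u z.1 z.2) (u z.1 z.2) +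
            p z.1 z.2 * (η z.1 * Δ ψ z.2)) univ volume :=
        hns.integrableOn_hessian_add_pressure_mul
          ((hηc'.comp continuous_fst).smul (hHc.comp continuous_snd))
          ((hηc'.comp continuous_fst).mul (hΔc.comp continuous_snd)) hC hCQ MeasurableSet.univ
          (fun z _ hzC => by
            rcases hout z hzC with h0 | ⟨h1, -⟩
            · simp [h0]
            · simp [h1])
          (fun z _ hzC => by
            rcases hout z hzC with h0 | ⟨-, h2⟩
            · simp [h0]
            · simp [h2])
      rw [integrableOn_univ] at h1
      refine h1.congr (Eventually.of_forall fun z => ?_)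
      simp only [hF, smul_apply, smul_eq_mul]
      ring
    have hset : ∫ z in (Q : Set (ℝ × E)), F z = ∫ z, F z :=
      setIntegral_eq_integral_of_forall_compl_eq_zero fun z hz => hF0 z fun hz' => hz (hCQ hz')
    have hiter : ∫ z, F z = ∫ t, ∫ x, F (t, x) := by
      rw [Measure.volume_eq_prod]
      exact integral_prod F (by rw [← Measure.volume_eq_prod]; exact hFi)
    have hin : ∀ t, ∫ x, F (t, x) = η t • g t := by
      intro t
      simp only [hF, hg, smul_eq_mul]
      exact integral_const_mul _ _
    calc ∫ t, η t • g t = ∫ t, ∫ x, F (t, x) := by simp_rw [hin]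
      _ = 0 := by rw [← hiter, ← hset]; exact hid'
  rw [ae_restrict_iff' measurableSet_Ioo]
  filter_upwards [hkey] with t ht htI
  exact ht htI

-- nested operator types
set_option maxSynthPendingDepth 3 in
/-- **The slice identity for all test functions at almost every time.** In the situation of
`ae_slice_pressure_identity`, for a.e. `t ∈ (a, b)` at which the slices `|u(t)|²` and `p(t)`
are locally integrable on `Ω` (and `u(t)` is a.e.-strongly measurable there), the pressure
equation holds on the slice against **every** test function on `Ω`:
`∫ p(t) Δψ = -∫ D²ψ(u(t), u(t))` for all `ψ ∈ C_c^∞(Ω)` (countably many test functions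
control all second-order jets, `exists_countable_testFunctions_dense_hessian`, and both
pairings pass to uniform limits). [cite: Seregin2014, §6.3 (proof of Prop. 3.10)] -/
theorem IsDistributionalNSSolutionOn.ae_forall_slice_pressure_identity
    (hns : IsDistributionalNSSolutionOn
      (⟨Ioo a b ×ˢ (Ω : Set E), isOpen_Ioo.prod Ω.isOpen⟩ : Opens (ℝ × E)) ν f u p)
    (hf : LocallyIntegrableOn (uncurry f) (Ioo a b ×ˢ (Ω : Set E)) volume)
    (hdivf : ∀ φ : ℝ → E → ℝ,
      IsSpaceTimeTestOn (⟨Ioo a b ×ˢ (Ω : Set E), isOpen_Ioo.prod Ω.isOpen⟩ : Opens (ℝ × E)) φ →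
      ∫ z in Ioo a b ×ˢ (Ω : Set E), ⟪f z.1 z.2, gradient (φ z.1) z.2⟫ = 0) :
    ∀ᵐ t ∂(volume.restrict (Ioo a b)),
      AEStronglyMeasurable (u t) (volume.restrict (Ω : Set E)) →
      LocallyIntegrableOn (fun x => ‖u t x‖ ^ 2) (Ω : Set E) volume →
      LocallyIntegrableOn (p t) (Ω : Set E) volume →
      ∀ ψ : E → ℝ, FunctionSpaces.IsTestFunctionOn Ω ψ →
        ∫ x, p t x * Δ ψ x = -∫ x, fderiv ℝ (fderiv ℝ ψ) x (u t x) (u t x) := by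
  obtain ⟨K, hKc, hKΩ, hKabs⟩ := exists_compact_exhaustion_absorbing Ω
  have hD := fun m => exists_countable_testFunctions_dense_hessian Ω (hKc m)
  choose D hDc hDT hDd using hD
  have hae : ∀ᵐ t ∂(volume.restrict (Ioo a b)), ∀ m, ∀ φ ∈ D m,
      ∫ x, (fderiv ℝ (fderiv ℝ φ) x (u t x) (u t x) + p t x * Δ φ x) = 0 := by
    rw [ae_all_iff]
    intro m
    rw [ae_ball_iff (hDc m)]
    intro φ hφ
    exact hns.ae_slice_pressure_identity hf hdivf (hDT m φ hφ).1
  filter_upwards [hae] with t ht hum hu2 hp ψ hψ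
  obtain ⟨m, hm⟩ := hKabs _ hψ.tsupport_subset hψ.hasCompactSupport
  obtain ⟨s, hsD, hsH, hsL⟩ := hDd m ψ hψ hm
  have hKm := hKc m
  have hu2K : IntegrableOn (fun x => ‖u t x‖ ^ 2) (K m) volume :=
    hu2.integrableOn_compact_subset (hKΩ m) hKm
  have hpK : IntegrableOn (p t) (K m) volume := hp.integrableOn_compact_subset (hKΩ m) hKm
  have humK : AEStronglyMeasurable (u t) (volume.restrict (K m)) :=
    hum.mono_measure (Measure.restrict_mono (hKΩ m) le_rfl)
  have hT : ∀ k, FunctionSpaces.IsTestFunctionOn Ω (s k) ∧ tsupport (s k) ⊆ K m := fun k =>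
    hDT m _ (hsD k)
  -- jets of test functions: continuity and vanishing off `K m`
  have hHc : ∀ {φ : E → ℝ}, FunctionSpaces.IsTestFunctionOn Ω φ →
      Continuous (fderiv ℝ (fderiv ℝ φ)) := fun hφ =>
    ((contDiff_infty.1 hφ.contDiff 2).fderiv_right (m := 1) (by norm_num)).continuous_fderiv
      one_ne_zero
  have hΔc : ∀ {φ : E → ℝ}, FunctionSpaces.IsTestFunctionOn Ω φ → Continuous (Δ φ) := fun hφ =>
    FluidPDE.continuous_laplacian (contDiff_infty.1 hφ.contDiff 2)
  have hH0 : ∀ {φ : E → ℝ}, tsupport φ ⊆ K m → ∀ x ∉ K m, fderiv ℝ (fderiv ℝ φ) x = 0 :=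
    fun hφ x hx => fderiv_fderiv_eq_zero_of_notMem_tsupport fun h => hx (hφ h)
  have hΔ0 : ∀ {φ : E → ℝ}, tsupport φ ⊆ K m → ∀ x ∉ K m, Δ φ x = 0 :=
    fun hφ x hx => FluidPDE.laplacian_eq_zero_of_notMem_tsupport fun h => hx (hφ h)
  -- integrability of the two pairings at time `t`
  have hiH : ∀ {φ : E → ℝ}, FunctionSpaces.IsTestFunctionOn Ω φ → tsupport φ ⊆ K m →
      Integrable (fun x => fderiv ℝ (fderiv ℝ φ) x (u t x) (u t x)) (volume : Measure E) :=
    fun hφ hφK =>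
      integrable_bilin_apply_self_of_eq_zero_off_compact hKm (hHc hφ) (hH0 hφK) humK hu2K
  have hiP : ∀ {φ : E → ℝ}, FunctionSpaces.IsTestFunctionOn Ω φ → tsupport φ ⊆ K m →
      Integrable (fun x => p t x * Δ φ x) (volume : Measure E) := fun hφ hφK =>
    (integrable_mul_of_eq_zero_off_compact hKm (hΔc hφ) (hΔ0 hφK) hpK).congr
      (Eventually.of_forall fun x => mul_comm _ _)
  -- the identity along the sequence, in split form
  have hk : ∀ k, ∫ x, p t x * Δ (s k) x = -∫ x, fderiv ℝ (fderiv ℝ (s k)) x (u t x) (u t x) := by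
    intro k
    have h0 := ht m (s k) (hsD k)
    rw [integral_add (hiH (hT k).1 (hT k).2) (hiP (hT k).1 (hT k).2)] at h0
    linarith
  -- pass to the limit in both pairings
  have e : ∀ φ : E → ℝ, (∫ x, Δ φ x * p t x) = ∫ x, p t x * Δ φ x := fun φ =>
    integral_congr_ae (Eventually.of_forall fun x => mul_comm _ _)
  have hlimP : Tendsto (fun k => ∫ x, p t x * Δ (s k) x) atTop (𝓝 (∫ x, p t x * Δ ψ x)) := by
    have h := tendsto_integral_mul_of_tendstoUniformly hKm hpK (fun k => hΔc (hT k).1) (hΔc hψ)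
      (fun k => hΔ0 (hT k).2) hsL
    rw [← e ψ]
    exact h.congr fun k => e (s k)
  have hlimH : Tendsto (fun k => -∫ x, fderiv ℝ (fderiv ℝ (s k)) x (u t x) (u t x)) atTop
      (𝓝 (-∫ x, fderiv ℝ (fderiv ℝ ψ) x (u t x) (u t x))) :=
    (tendsto_integral_bilin_apply_self_of_tendstoUniformly hKm humK hu2K (fun k => hHc (hT k).1)
      (hHc hψ) (fun k => hH0 (hT k).2) hsH).neg
  exact tendsto_nhds_unique hlimP (hlimH.congr fun k => (hk k).symm)

end SliceIdentity

/-! ### The space–time estimate -/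

section Assembly

/-- **The local pressure decay estimate from Stein's bound** (discharge of
`seregin_sverak_pressure_decay` modulo the Calderón–Zygmund bound on test fields). Assume
`stein1970_normalisedPressure_Lp_bound`. Then there is an absolute constant `c` such that for
every distributional solution `(u, p)` of the Navier–Stokes equations (`ν = 1`, no force) on an
open `Q ⊇ Q_r(z)` and all `0 < ϱ ≤ r`,
`D(ϱ) ≤ c [ (ϱ/r) D(r) + (r/ϱ)² C(r) ]` (Seregin–Šverák 2009, (as13); Seregin 2005,
(p10)–(p12)). Proof: if `D(r)` or `C(r)` is infinite there is nothing to prove; if `ϱ > r/2` the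
estimate is the monotonicity `D(ϱ) ≤ (r/ϱ)² D(r) ≤ 8 (ϱ/r) D(r)`; otherwise restrict the
solution to `Q_r(z) = (t₀ - r², t₀) × B_r(x₀)` (`IsDistributionalNSSolutionOn.of_le`), slice the
pressure equation (`ae_forall_slice_pressure_identity`; the slices `u(t) ∈ L³(B_r)`,
`p(t) ∈ L^{3/2}(B_r)` for a.e. `t` by Tonelli), apply the one-slice estimate
`setLIntegral_pressure_ball_le_of_stein` for a.e. `t ∈ (t₀ - ϱ², t₀)` and integrate in time
(Tonelli), using `ϱ⁻² (ϱ/r)³ = (ϱ/r) r⁻²` and `ϱ⁻² = (r/ϱ)² r⁻²`.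
[cite: SereginSverak2009, (as13)][cite: Seregin2005, (p10)–(p12)] -/
theorem seregin_sverak_pressure_decay_of_stein (hS : stein1970_normalisedPressure_Lp_bound) :
    seregin_sverak_pressure_decay := by
  obtain ⟨c₄, hc₄⟩ := setLIntegral_pressure_ball_le_of_stein hS
  refine ⟨8 * (c₄ + 1), fun Q u p hns z r ϱ hϱ hϱr hQr => ?_⟩
  have hr : 0 < r := hϱ.trans_le hϱr
  set c : ℝ≥0∞ := ((8 * (c₄ + 1) : ℝ≥0) : ℝ≥0∞) with hc
  have hc0 : c ≠ 0 := by
    rw [hc]; exact ENNReal.coe_ne_zero.2 (ne_of_gt (by positivity))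
  have h8c : (8 : ℝ≥0∞) ≤ c := by
    rw [hc]
    exact_mod_cast le_mul_of_one_le_right (by norm_num) (le_add_of_nonneg_left (by simp))
  have hc₄c : (c₄ : ℝ≥0∞) ≤ c := by
    rw [hc]
    exact_mod_cast (le_add_of_nonneg_right zero_le_one).trans
      (le_mul_of_one_le_left (by simp) (by norm_num))
  -- the scaled quantities
  set Ip : ℝ≥0∞ := ∫⁻ q in parabolicCylinder r z, ‖p q.1 q.2‖ₑ ^ (3 / 2 : ℝ) with hIp
  set Iu : ℝ≥0∞ := ∫⁻ q in parabolicCylinder r z, ‖u q.1 q.2‖ₑ ^ (3 : ℕ) with hIu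
  have hD : cknD r z p = (ENNReal.ofReal r ^ 2)⁻¹ * Ip := rfl
  have hC : cknC r z u = (ENNReal.ofReal r ^ 2)⁻¹ * Iu := rfl
  have hDϱ : cknD ϱ z p = (ENNReal.ofReal ϱ ^ 2)⁻¹ *
      ∫⁻ q in parabolicCylinder ϱ z, ‖p q.1 q.2‖ₑ ^ (3 / 2 : ℝ) := rfl
  have hR0 : (ENNReal.ofReal r ^ 2)⁻¹ ≠ 0 :=
    ENNReal.inv_ne_zero.2 (ENNReal.pow_ne_top ENNReal.ofReal_ne_top)
  have hθ0 : ENNReal.ofReal (ϱ / r) ≠ 0 := (ENNReal.ofReal_pos.2 (div_pos hϱ hr)).ne'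
  have hκ0 : ENNReal.ofReal ((r / ϱ) ^ 2) ≠ 0 :=
    (ENNReal.ofReal_pos.2 (pow_pos (div_pos hr hϱ) 2)).ne'
  -- Case 1: an infinite right-hand side
  by_cases htop : Ip = ⊤ ∨ Iu = ⊤
  · have hRHS : c * (ENNReal.ofReal (ϱ / r) * cknD r z p +
        ENNReal.ofReal ((r / ϱ) ^ 2) * cknC r z u) = ⊤ := by
      rcases htop with h | h
      · rw [hD, h, ENNReal.mul_top hR0, ENNReal.mul_top hθ0, top_add, ENNReal.mul_top hc0]
      · rw [hC, h, ENNReal.mul_top hR0, ENNReal.mul_top hκ0, add_top, ENNReal.mul_top hc0]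
    rw [hRHS]
    exact le_top
  push Not at htop
  obtain ⟨hIpt, hIut⟩ := htop
  -- monotonicity in the radius and the scale factors
  have hmono : parabolicCylinder ϱ z ⊆ parabolicCylinder r z :=
    prod_mono (Ioo_subset_Ioo (by nlinarith) le_rfl) (ball_subset_ball hϱr)
  have hscale : (ENNReal.ofReal ϱ ^ 2)⁻¹ =
      ENNReal.ofReal ((r / ϱ) ^ 2) * (ENNReal.ofReal r ^ 2)⁻¹ := by
    rw [← ENNReal.ofReal_pow hϱ.le, ← ENNReal.ofReal_pow hr.le,
      (ENNReal.ofReal_inv_of_pos (pow_pos hϱ 2)).symm,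
      (ENNReal.ofReal_inv_of_pos (pow_pos hr 2)).symm,
      ← ENNReal.ofReal_mul (sq_nonneg _)]
    congr 1
    field_simp
  have hcrude : cknD ϱ z p ≤ ENNReal.ofReal ((r / ϱ) ^ 2) * cknD r z p := by
    rw [hDϱ, hD, hscale, mul_assoc]
    exact mul_le_mul_right (mul_le_mul_right (lintegral_mono_set hmono) _) _
  -- Case 2: `r < 2ϱ`, monotonicity suffices
  by_cases h2 : r < 2 * ϱ
  · have hq : r / ϱ < 2 := (div_lt_iff₀ hϱ).2 (by linarith)
    have hq0 : 0 ≤ r / ϱ := div_nonneg hr.le hϱ.le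
    have h4 : ENNReal.ofReal ((r / ϱ) ^ 2) ≤ 4 := by
      rw [← ENNReal.ofReal_ofNat 4]
      exact ENNReal.ofReal_le_ofReal (by nlinarith)
    have hhalf : ENNReal.ofReal (1 / 2) ≤ ENNReal.ofReal (ϱ / r) :=
      ENNReal.ofReal_le_ofReal (by rw [le_div_iff₀ hr]; linarith)
    have h48 : (4 : ℝ≥0∞) = 8 * ENNReal.ofReal (1 / 2) := by
      rw [← ENNReal.ofReal_ofNat 8, ← ENNReal.ofReal_mul (by norm_num), ← ENNReal.ofReal_ofNat 4]
      norm_num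
    calc cknD ϱ z p ≤ ENNReal.ofReal ((r / ϱ) ^ 2) * cknD r z p := hcrude
      _ ≤ 4 * cknD r z p := mul_le_mul_left h4 _
      _ = 8 * ENNReal.ofReal (1 / 2) * cknD r z p := by rw [h48]
      _ ≤ c * ENNReal.ofReal (ϱ / r) * cknD r z p :=
          mul_le_mul_left (mul_le_mul' h8c hhalf) _
      _ = c * (ENNReal.ofReal (ϱ / r) * cknD r z p) := mul_assoc _ _ _
      _ ≤ c * (ENNReal.ofReal (ϱ / r) * cknD r z p +
            ENNReal.ofReal ((r / ϱ) ^ 2) * cknC r z u) := mul_le_mul_right le_self_add _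
  push Not at h2
  -- Case 3: `2ϱ ≤ r`; restrict the solution to `Q_r(z) = (t₀ - r², t₀) × B_r(x₀)`
  set Ω : Opens (EuclideanSpace ℝ (Fin 3)) := ⟨ball z.2 r, isOpen_ball⟩ with hΩ
  have hns' : IsDistributionalNSSolutionOn
      (⟨Ioo (z.1 - r ^ 2) z.1 ×ˢ (Ω : Set (EuclideanSpace ℝ (Fin 3))),
        isOpen_Ioo.prod Ω.isOpen⟩ : Opens (ℝ × EuclideanSpace ℝ (Fin 3))) 1 0 u p :=
    hns.of_le fun w hw => hQr hw
  have hf0 : LocallyIntegrableOn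
      (uncurry (0 : ℝ → EuclideanSpace ℝ (Fin 3) → EuclideanSpace ℝ (Fin 3)))
      (Ioo (z.1 - r ^ 2) z.1 ×ˢ (Ω : Set (EuclideanSpace ℝ (Fin 3)))) volume :=
    locallyIntegrableOn_const _
  have hdiv0 : ∀ φ : ℝ → EuclideanSpace ℝ (Fin 3) → ℝ,
      IsSpaceTimeTestOn (⟨Ioo (z.1 - r ^ 2) z.1 ×ˢ (Ω : Set (EuclideanSpace ℝ (Fin 3))),
        isOpen_Ioo.prod Ω.isOpen⟩ : Opens (ℝ × EuclideanSpace ℝ (Fin 3))) φ →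
      ∫ q in Ioo (z.1 - r ^ 2) z.1 ×ˢ (Ω : Set (EuclideanSpace ℝ (Fin 3))),
        ⟪(0 : ℝ → EuclideanSpace ℝ (Fin 3) → EuclideanSpace ℝ (Fin 3)) q.1 q.2,
          gradient (φ q.1) q.2⟫ = 0 := fun φ _ => by simp
  -- Tonelli data on `Q_r(z)`
  set μt : Measure ℝ := volume.restrict (Ioo (z.1 - r ^ 2) z.1) with hμt
  set μx : Measure (EuclideanSpace ℝ (Fin 3)) := volume.restrict (ball z.2 r) with hμx
  have hprod : μt.prod μx = volume.restrict (parabolicCylinder r z) := by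
    rw [hμt, hμx, Measure.prod_restrict, ← Measure.volume_eq_prod]
    rfl
  have hpm : AEStronglyMeasurable (uncurry p) (μt.prod μx) := by
    rw [hprod]; exact hns'.2.2.1.aestronglyMeasurable
  have hum : AEStronglyMeasurable (uncurry u) (μt.prod μx) := by
    rw [hprod]; exact hns'.1.aestronglyMeasurable
  have hGp : AEMeasurable (fun q : ℝ × EuclideanSpace ℝ (Fin 3) => ‖p q.1 q.2‖ₑ ^ (3 / 2 : ℝ))
      (μt.prod μx) := hpm.enorm.pow_const _
  have hGu : AEMeasurable (fun q : ℝ × EuclideanSpace ℝ (Fin 3) => ‖u q.1 q.2‖ₑ ^ (3 : ℕ))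
      (μt.prod μx) := hum.enorm.pow_const _
  have hIp_it : Ip = ∫⁻ t, ∫⁻ x, ‖p t x‖ₑ ^ (3 / 2 : ℝ) ∂μx ∂μt := by
    rw [hIp, ← hprod, lintegral_prod _ hGp]
  have hIu_it : Iu = ∫⁻ t, ∫⁻ x, ‖u t x‖ₑ ^ (3 : ℕ) ∂μx ∂μt := by
    rw [hIu, ← hprod, lintegral_prod _ hGu]
  have hAp : AEMeasurable (fun t => ∫⁻ x, ‖p t x‖ₑ ^ (3 / 2 : ℝ) ∂μx) μt :=
    hGp.lintegral_prod_right'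
  -- a.e. in time: finite slices, measurable slices, the pressure equation on the slice
  have hfp : ∀ᵐ t ∂μt, ∫⁻ x, ‖p t x‖ₑ ^ (3 / 2 : ℝ) ∂μx < ⊤ :=
    ae_lt_top' hGp.lintegral_prod_right' (by rw [← hIp_it]; exact hIpt)
  have hfu : ∀ᵐ t ∂μt, ∫⁻ x, ‖u t x‖ₑ ^ (3 : ℕ) ∂μx < ⊤ :=
    ae_lt_top' hGu.lintegral_prod_right' (by rw [← hIu_it]; exact hIut)
  have hmp : ∀ᵐ t ∂μt, AEStronglyMeasurable (p t) μx := by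
    filter_upwards [hpm.prodMk_left] with t ht
    exact ht
  have hmu : ∀ᵐ t ∂μt, AEStronglyMeasurable (u t) μx := by
    filter_upwards [hum.prodMk_left] with t ht
    exact ht
  have hid := hns'.ae_forall_slice_pressure_identity hf0 hdiv0
  -- exponent bookkeeping for the slice memberships
  have h32 : (3 / 2 : ℝ≥0∞).toReal = 3 / 2 := by rw [ENNReal.toReal_div]; norm_num
  have h32_0 : (3 / 2 : ℝ≥0∞) ≠ 0 := by norm_num
  have h32_t : (3 / 2 : ℝ≥0∞) ≠ ⊤ := (ENNReal.div_lt_top ENNReal.ofNat_ne_top two_ne_zero).ne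
  have h1le : (1 : ℝ≥0∞) ≤ 3 / 2 := by
    rw [ENNReal.le_div_iff_mul_le (Or.inl two_ne_zero) (Or.inl ENNReal.ofNat_ne_top)]; norm_num
  have h3rpow : ∀ y : ℝ≥0∞, y ^ (3 : ℝ) = y ^ (3 : ℕ) := fun y => by
    rw [show (3 : ℝ) = ((3 : ℕ) : ℝ) by norm_num, ENNReal.rpow_natCast]
  haveI hfin : IsFiniteMeasure μx :=
    ⟨by rw [hμx, Measure.restrict_apply_univ]; exact measure_ball_lt_top⟩
  -- the slice estimate, a.e. in `t ∈ (t₀ - r², t₀)`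
  have hslice : ∀ᵐ t ∂μt, ∫⁻ x in ball z.2 ϱ, ‖p t x‖ₑ ^ (3 / 2 : ℝ) ≤
      c₄ * (ENNReal.ofReal ((ϱ / r) ^ 3) * (∫⁻ x, ‖p t x‖ₑ ^ (3 / 2 : ℝ) ∂μx) +
        ∫⁻ x, ‖u t x‖ₑ ^ (3 : ℕ) ∂μx) := by
    filter_upwards [hfp, hfu, hmp, hmu, hid] with t hfp hfu hmp hmu hid
    have hpmem : MemLp (p t) (3 / 2) μx := by
      refine ⟨hmp, ?_⟩
      rw [eLpNorm_eq_lintegral_rpow_enorm_toReal h32_0 h32_t, h32]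
      exact ENNReal.rpow_lt_top_of_nonneg (by norm_num) hfp.ne
    have humem : MemLp (u t) 3 μx := by
      refine ⟨hmu, ?_⟩
      rw [eLpNorm_eq_lintegral_rpow_enorm_toReal (by norm_num) (by norm_num), ENNReal.toReal_ofNat]
      simp_rw [h3rpow]
      exact ENNReal.rpow_lt_top_of_nonneg (by norm_num) hfu.ne
    have hp1 : LocallyIntegrableOn (p t) (Ω : Set (EuclideanSpace ℝ (Fin 3))) volume := by
      have h : IntegrableOn (p t) (ball z.2 r) volume := hpmem.integrable h1le
      exact h.locallyIntegrableOn
    have hu2 : LocallyIntegrableOn (fun x => ‖u t x‖ ^ 2) (Ω : Set (EuclideanSpace ℝ (Fin 3)))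
        volume := by
      have h2 : MemLp (u t) 2 μx := humem.mono_exponent (by norm_num)
      have h : IntegrableOn (fun x => ‖u t x‖ ^ 2) (ball z.2 r) volume :=
        (memLp_two_iff_integrable_sq_norm hmu).1 h2
      exact h.locallyIntegrableOn
    have hidt := hid hmu hu2 hp1
    exact hc₄ z.2 r ϱ (p t) (u t) hϱ h2 hmp hmu hfp hfu fun ψ hψ hψc hψs =>
      hidt ψ ⟨hψ, hψc, hψs⟩
  -- integrate over `t ∈ (t₀ - ϱ², t₀)`
  set μt' : Measure ℝ := volume.restrict (Ioo (z.1 - ϱ ^ 2) z.1) with hμt'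
  set μx' : Measure (EuclideanSpace ℝ (Fin 3)) := volume.restrict (ball z.2 ϱ) with hμx'
  have hsub_t : Ioo (z.1 - ϱ ^ 2) z.1 ⊆ Ioo (z.1 - r ^ 2) z.1 :=
    Ioo_subset_Ioo (by nlinarith) le_rfl
  have hμt'le : μt' ≤ μt := by
    rw [hμt', hμt]; exact Measure.restrict_mono hsub_t le_rfl
  have hslice' : ∀ᵐ t ∂μt', ∫⁻ x in ball z.2 ϱ, ‖p t x‖ₑ ^ (3 / 2 : ℝ) ≤
      c₄ * (ENNReal.ofReal ((ϱ / r) ^ 3) * (∫⁻ x, ‖p t x‖ₑ ^ (3 / 2 : ℝ) ∂μx) +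
        ∫⁻ x, ‖u t x‖ₑ ^ (3 : ℕ) ∂μx) :=
    ae_restrict_of_ae_restrict_of_subset hsub_t hslice
  have hprod' : μt'.prod μx' = volume.restrict (parabolicCylinder ϱ z) := by
    rw [hμt', hμx', Measure.prod_restrict, ← Measure.volume_eq_prod]
    rfl
  have hpmϱ : AEStronglyMeasurable (uncurry p) (μt'.prod μx') := by
    rw [hprod']
    have h := hpm
    rw [hprod] at h
    exact h.mono_measure (Measure.restrict_mono hmono le_rfl)
  have hGpϱ : AEMeasurable (fun q : ℝ × EuclideanSpace ℝ (Fin 3) => ‖p q.1 q.2‖ₑ ^ (3 / 2 : ℝ))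
      (μt'.prod μx') := hpmϱ.enorm.pow_const _
  have hIϱ : ∫⁻ q in parabolicCylinder ϱ z, ‖p q.1 q.2‖ₑ ^ (3 / 2 : ℝ) =
      ∫⁻ t, ∫⁻ x, ‖p t x‖ₑ ^ (3 / 2 : ℝ) ∂μx' ∂μt' := by
    rw [← hprod', lintegral_prod _ hGpϱ]
  have key : ∫⁻ q in parabolicCylinder ϱ z, ‖p q.1 q.2‖ₑ ^ (3 / 2 : ℝ) ≤
      c₄ * (ENNReal.ofReal ((ϱ / r) ^ 3) * Ip + Iu) := by
    calc ∫⁻ q in parabolicCylinder ϱ z, ‖p q.1 q.2‖ₑ ^ (3 / 2 : ℝ)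
        = ∫⁻ t, ∫⁻ x, ‖p t x‖ₑ ^ (3 / 2 : ℝ) ∂μx' ∂μt' := hIϱ
      _ ≤ ∫⁻ t, c₄ * (ENNReal.ofReal ((ϱ / r) ^ 3) * (∫⁻ x, ‖p t x‖ₑ ^ (3 / 2 : ℝ) ∂μx) +
            ∫⁻ x, ‖u t x‖ₑ ^ (3 : ℕ) ∂μx) ∂μt' := lintegral_mono_ae hslice'
      _ ≤ ∫⁻ t, c₄ * (ENNReal.ofReal ((ϱ / r) ^ 3) * (∫⁻ x, ‖p t x‖ₑ ^ (3 / 2 : ℝ) ∂μx) +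
            ∫⁻ x, ‖u t x‖ₑ ^ (3 : ℕ) ∂μx) ∂μt := lintegral_mono' hμt'le le_rfl
      _ = c₄ * (ENNReal.ofReal ((ϱ / r) ^ 3) * (∫⁻ t, (∫⁻ x, ‖p t x‖ₑ ^ (3 / 2 : ℝ) ∂μx) ∂μt) +
            ∫⁻ t, (∫⁻ x, ‖u t x‖ₑ ^ (3 : ℕ) ∂μx) ∂μt) := by
          rw [lintegral_const_mul' _ _ ENNReal.coe_ne_top,
            lintegral_add_left' (hAp.const_mul _), lintegral_const_mul' _ _ ENNReal.ofReal_ne_top]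
      _ = c₄ * (ENNReal.ofReal ((ϱ / r) ^ 3) * Ip + Iu) := by rw [← hIp_it, ← hIu_it]
  -- conclusion
  have hθ' : ENNReal.ofReal ((r / ϱ) ^ 2) * ENNReal.ofReal ((ϱ / r) ^ 3) =
      ENNReal.ofReal (ϱ / r) := by
    rw [← ENNReal.ofReal_mul (sq_nonneg _)]
    congr 1
    field_simp
  calc cknD ϱ z p
      = (ENNReal.ofReal ϱ ^ 2)⁻¹ * ∫⁻ q in parabolicCylinder ϱ z, ‖p q.1 q.2‖ₑ ^ (3 / 2 : ℝ) := hDϱ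
    _ ≤ (ENNReal.ofReal ϱ ^ 2)⁻¹ * (c₄ * (ENNReal.ofReal ((ϱ / r) ^ 3) * Ip + Iu)) :=
        mul_le_mul_right key _
    _ = c₄ * (ENNReal.ofReal (ϱ / r) * cknD r z p +
          ENNReal.ofReal ((r / ϱ) ^ 2) * cknC r z u) := by
        rw [hD, hC, hscale, ← hθ']
        ring
    _ ≤ c * (ENNReal.ofReal (ϱ / r) * cknD r z p +
          ENNReal.ofReal ((r / ϱ) ^ 2) * cknC r z u) := mul_le_mul_left hc₄c _

/-! ### Unconditional forms -/

-- nested operator types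
set_option maxSynthPendingDepth 3 in
/-- **The whole-space pressure of an `L³` field** (unconditional form of
`exists_wholeSpacePressure_of_stein`, by the tree's proof
`stein1970_normalisedPressure_Lp_bound_holds` of Stein's bound): there is `C` such that every
`U ∈ L³(ℝ³; ℝ³)` admits `P ∈ L^{3/2}(ℝ³)` with `‖P‖_{3/2} ≤ C ‖U‖₃²` and
`∫ P Δφ = -∫ D²φ(U, U)` for all test functions `φ` (`-Δ P = ∂ᵢ∂ⱼ(UᵢUⱼ)` in `𝒟'(ℝ³)`;
Seregin 2014, §6.3: "`Δ p₁ = -div div (χ_B u ⊗ u)` in `ℝ³`" with "the standard estimate").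
[cite: Seregin2014, §6.3 (proof of Prop. 3.10)][cite: Stein1971, Ch. II §4.2 Thm 3] -/
theorem exists_wholeSpacePressure_three :
    ∃ C : ℝ≥0, ∀ U : EuclideanSpace ℝ (Fin 3) → EuclideanSpace ℝ (Fin 3), MemLp U 3 volume →
      ∃ P : EuclideanSpace ℝ (Fin 3) → ℝ, MemLp P (3 / 2) volume ∧
        eLpNorm P (3 / 2) volume ≤ C * eLpNorm U 3 volume ^ 2 ∧
        ∀ φ : EuclideanSpace ℝ (Fin 3) → ℝ, ContDiff ℝ (⊤ : ℕ∞) φ → HasCompactSupport φ →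
          ∫ x, P x * (Δ φ) x = -∫ x, fderiv ℝ (fderiv ℝ φ) x (U x) (U x) :=
  exists_wholeSpacePressure_of_stein stein1970_normalisedPressure_Lp_bound_holds

-- nested operator types
set_option maxSynthPendingDepth 3 in
/-- **Pressure decay on balls, one time slice, unconditionally** (Seregin 2005, (p9)–(p12);
unconditional form of `setLIntegral_pressure_ball_le_of_stein` by
`stein1970_normalisedPressure_Lp_bound_holds`): an absolute `c` with
`∫_{B_ϱ} |p|^{3/2} ≤ c ((ϱ/r)³ ∫_{B_r} |p|^{3/2} + ∫_{B_r} |u|³)` whenever `2ϱ ≤ r`,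
`p ∈ L^{3/2}(B_r)`, `u ∈ L³(B_r)` and `∫ p Δψ = -∫ D²ψ(u, u)` for all test functions `ψ`
supported in `B_r`. [cite: Seregin2005, (p9)–(p12)][cite: SereginSverak2009, (as13)] -/
theorem setLIntegral_pressure_ball_le :
    ∃ c : ℝ≥0, ∀ (x₀ : EuclideanSpace ℝ (Fin 3)) (r ϱ : ℝ) (p : EuclideanSpace ℝ (Fin 3) → ℝ)
      (u : EuclideanSpace ℝ (Fin 3) → EuclideanSpace ℝ (Fin 3)), 0 < ϱ → 2 * ϱ ≤ r →
      AEStronglyMeasurable p (volume.restrict (ball x₀ r)) →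
      AEStronglyMeasurable u (volume.restrict (ball x₀ r)) →
      ∫⁻ x in ball x₀ r, ‖p x‖ₑ ^ (3 / 2 : ℝ) < ⊤ →
      ∫⁻ x in ball x₀ r, ‖u x‖ₑ ^ (3 : ℕ) < ⊤ →
      (∀ ψ : EuclideanSpace ℝ (Fin 3) → ℝ, ContDiff ℝ (⊤ : ℕ∞) ψ → HasCompactSupport ψ →
        tsupport ψ ⊆ ball x₀ r →
        ∫ x, p x * (Δ ψ) x = -∫ x, fderiv ℝ (fderiv ℝ ψ) x (u x) (u x)) →
      ∫⁻ x in ball x₀ ϱ, ‖p x‖ₑ ^ (3 / 2 : ℝ) ≤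
        c * (ENNReal.ofReal ((ϱ / r) ^ 3) * (∫⁻ x in ball x₀ r, ‖p x‖ₑ ^ (3 / 2 : ℝ)) +
          ∫⁻ x in ball x₀ r, ‖u x‖ₑ ^ (3 : ℕ)) :=
  setLIntegral_pressure_ball_le_of_stein stein1970_normalisedPressure_Lp_bound_holds

end Assembly

end Literature.Analysis.FluidPDE

end
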